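/-
Copyright (c) 2026 the pub-hodgecm-mathlib formalisation cell (harness21).  Prover seat hodgecm-mathlib-F0P3-p01 (g30), «(D-RAM) FOUR-FRAME» road of crux H413, line LH4, unit U3 §K-R
(dealer LH4-plan (g10) WORD #44 free-hand routing «F0P3-p01 → K-ABS-R payer road»): the (R-17)-shaped REDUCTION of the re-cut κ-AMPLITUDE law `stub_U3_kappaAbsLawR` to ONE frame-free
statement — the κ-weighted diagonal-model counts («κ-MODEL SUM», KMS) — over ★ (NI2) `normIndexTwo` and the ★ four-frame bookkeeping of LH4-p10 (g0) (★ p855032, ★ p855115).  2026-09-03∕04.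
-/
import Summits.HodgeConjecture.HodgeConjecture.Theorems.F0P3cDyRamStableSumSignClasses   -- ★ p855115 (LH4-p10 (g0)): `exists_rep_of_dichotomy`, `normSign_eq_one_or`; brings ★ p855032 `fixedVertexCount_frameElt_eq_ncard_diagonal_model`, `ncard_fixed_diagonal_eq_of_exists_norm`, ★ #0a `UnitaryThreeFourFrameDefs`
import Summits.HodgeConjecture.HodgeConjecture.Theorems.F0P3cDyRamFourFrameLawDefsR        -- ★ №1-R (F0P3a-p01 (g30)): `KappaAmplitudeLawAtS∕AtR`, `shiftR`; brings ★ №1 `DyadicFence`, `dyadicFence_of`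
import Summits.HodgeConjecture.HodgeConjecture.Theorems.F0P3cDyRamNormIndexTwo            -- ★ p855402 (this seat; legs ★ p855352 ∕ p855374 LH4-p09 (g2)): `normIndexTwo` = (NI2) at every datum
import HarnessLib

/-!
# F0 · P3c · line LH4 «(D-RAM) FOUR-FRAME» — unit U3 §K-R: THE κ-AMPLITUDE LAW AT A DATUM FROM (NI2) + THE κ-MODEL SUM (KMS) — the four-frame bookkeeping of the
# κ-weighted sums, frame by frame (Rogawski 1990 §3.6, §4.9 Prop. 4.9.1 (a); Langlands–Shelstad 1987 §1.3)

Cell `pub/hodgecm-mathlib`, crux H413 = `stmt-HodgeConjecture-24833` (helper lane `--supports stmt-HodgeConjecture-24833 --as helper`), route HCCMUnconditional; THEOREMS ONLY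
(no definition, no instance, no notation, no named fact, no `sorry`, no `set_option` beyond `autoImplicit false`; default heartbeats).

WHAT IS PROVED — the κ-twin of ★ p855240 `stableLawAt_of_normIndexTwo_of_modelSum` ((R-17) «NI2 ⊕ MS» for the STABLE law).  For any depth-shift schedule `shift`, threshold `N₀`, type
shift `τ` and datum `(K, σ, ϖ, d, t)`:  if (NI2) some `σ`-fixed unit `c` satisfies the index-two dichotomy and (KMS) for every such `c`, every reading `ω ∈ Bool` of the class of `−1`
(`ω = true ↔ ω(−1) = −1`), every element datum `(α, β; n₁, n₂, n₃)` at `N₀ d`, the diagonal literal `T = diag(α, β, 1)`, every `k` with `2k + d = Σn + 2` and every parity datum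
`2B = n_i − d + 2 − 2·shift d t`:
  `|Σ_{b : Fin 4} κ_i(b) · C₀(s_ω b)| = ampl q k B`  and  `|Σ_b κ_i(b) · C₂(s_ω b)| = ampl q k (B + τ d)`,
where `C_t(s) = #{M : M a type-t vertex lattice of (K³, diag(d_s)), T·M = M}`, `d_s j = c` if `s j` else `1`, and `s_ω b = (ε₁(b) = −1, ε₂(b) = −1, (ε₁ε₂)(b) = −1 XOR ω)` is the
sign class of the frame `b` (★ p855115's tables `e₁ = (ff,ff,tt,tt)`, `e₂ = (ff,tt,ff,tt)`, `e₁₂ = (ff,tt,tt,ff)` — the SAME table as ★ #0a `kappaChar`∕`signPair`), THEN `KappaAmplitudeLawAtS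
shift N₀ τ σ ϖ d t` (★ №1-R §S, verbatim) holds — `kappaAmplitudeLawAtS_of_normIndexTwo_of_kappaModelSum`.  At the schedule of record `shiftR` and the parameters of record
`(depthOfRecord, tauOfRecord)`, with (NI2) DISCHARGED by ★ `normIndexTwo`, this reads **`dyadicFence_kappaAmplitudeLawAtR_of_kappaModelSum (σ ϖ d t) (hKMS) :
DyadicFence (KappaAmplitudeLawAtR depthOfRecord tauOfRecord σ ϖ d t)`** — the conclusion of `U3_Laws.stub_U3_kappaAbsLawR` at the datum from ONE frame-free binder (KMS).  So the
κ-amplitude head can be RE-LINED «K-ABS-R := KMS» exactly as T18-15 (R-17) re-lined the stable heads, the bookkeeping being discharged here once and for all.  Nothing is claimed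
about (KMS): it is a BINDER — the κ-weighted, per-class refinement of (MS), i.e. of the (S-fin) engine's per-(frame, type) counts.

THE MATHEMATICS ([Rogawski1990, §3.6 pp. 28–29, §4.9 p. 55]; [LanglandsShelstad1987, §1.3]; [Jacobowitz1962, §4]).  §1 is ★ p855115's step (A), EXPORTED frame by frame: by ★ p855032
each `Γ_b = frameElt σ f b α β` is counted in a unit diagonal model `diag(d)` with `(ω(d₀), ω(d₁), ω(d₂)) = (ε₁, ε₂, ω(−1)ε₁ε₂)`, `(ε₁, ε₂) = signPair b`; by the dichotomy every `d_j` is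
`σz·r·z` with `r ∈ {1, c}` its class representative (★ `exists_rep_of_dichotomy`), so ★ `ncard_fixed_diagonal_eq_of_exists_norm` moves the count to the representative form
`diag(d_{s_ω b})`: `n_t(Γ_b) = C_t(s_ω b)` (`fixedVertexCount_frameElt_eq_ncard_signClass`).  §2 rewrites the κ-weighted sums frame by frame (`kappaSum_fixedVertexCount_eq`, sign-EXACT —
it serves the κ-SIGN law as well).  §3 unfolds ★ №1-R's `KappaAmplitudeLawAtS`, builds `T = diag(α, β, 1) ∈ GL₃` (`α·σα = β·σβ = 1` from the element datum) and reads `ω` off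
`normSign σ (−1)`.

* §1 **`fixedVertexCount_frameElt_eq_ncard_signClass`**.   §2 `kappaSum_fixedVertexCount_eq`.
* §3 **`kappaAmplitudeLawAtS_of_normIndexTwo_of_kappaModelSum`**, `dyadicFence_kappaAmplitudeLawAtS_of_normIndexTwo_of_kappaModelSum`,
  **`dyadicFence_kappaAmplitudeLawAtR_of_kappaModelSum`** (the record instance, (NI2) discharged).

HONEST LABEL: HC_CM is proved only modulo the 7 printed citations (2 remaining named inputs: hLiu418 = stmt-HodgeConjecture-24832, h413 = stmt-HodgeConjecture-24833) until
rung 0 closes; count-neutral (`--supports`); (KMS) is a census law in model currency — a PROVER TARGET, never a literature fact; the verdict of record for (D-RAM) stays PRINT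
[LanglandsShelstad1989 Thm. p. 484 ∕ Rogawski1990 Prop. 4.9.1 (a)].

## References
* [Rogawski1990] J. D. Rogawski, *Automorphic Representations of Unitary Groups in Three Variables*, Ann. of Math. Stud. 123 (1990), §3.6 pp. 28–29 (the classes in a stable class),
  §4.9 Prop. 4.9.1 (a) p. 55 (orbital integrals of near-identity elements as fixed-lattice counts), §12.2.
* [LanglandsShelstad1987] R. P. Langlands, D. Shelstad, *On the definition of transfer factors*, Math. Ann. 278 (1987), §1.3 (`𝔇(T)` and the κ-signs of the classes in a stable class).
* [Jacobowitz1962] R. Jacobowitz, *Hermitian forms over local fields*, Amer. J. Math. 84 (1962), §4 (diagonal forms, norm classes of the coefficients).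
* [Kottwitz1986BaseChangeUnits] R. E. Kottwitz, *Base change for unit elements of Hecke algebras*, Compositio Math. 60 (1986), §1 pp. 240–241 (fixed-lattice counting).
-/

set_option autoImplicit false

noncomputable section

namespace Summit.HodgeConjecture.HodgeConjecture.Cruxes.H413.F0P3cDyRamKappaLawOfModelCounts

open Matrix
open Literature.NumberTheory.Automorphic Literature.NumberTheory.Automorphic.HermitianLattice Literature.NumberTheory.Automorphic.UnitaryGroup
open Literature.NumberTheory.Automorphic.UnitaryLatticeTree Literature.NumberTheory.Automorphic.UnitaryThreeFourFrame
open Summit.HodgeConjecture.HodgeConjecture.Cruxes.H413.F0P3cDyRamFixedCountDiagonalModel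
open Summit.HodgeConjecture.HodgeConjecture.Cruxes.H413.F0P3cDyRamStableSumSignClasses
open Summit.HodgeConjecture.HodgeConjecture.Cruxes.H413.F0P3cDyRamFourFrameLawDefs
open Summit.HodgeConjecture.HodgeConjecture.Cruxes.H413.F0P3cDyRamFourFrameLawDefsR
open Summit.HodgeConjecture.HodgeConjecture.Cruxes.H413.F0P3cDyRamNormIndexTwo
open scoped Valued WithZero Matrix MatrixGroups

/-! ## §1 ★ p855115's step (A), frame by frame: `n_t(Γ_b)` is the diagonal-model count of the frame's sign class `s_ω(b)` -/

section PerFrame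

variable {K : Type} [Field K] [Valued K ℤᵐ⁰] {σ : K →+* K} {ϖ : K}

/-- **EACH FRAME IS COUNTED BY ITS SIGN CLASS.**  Under the datum clauses, with `c` a `σ`-fixed unit satisfying the index-two dichotomy, `ω ∈ Bool` the class of `−1` (`ω(−1) = −1 ↔ ω`),
`f` a four-frame family, `T = diag(α, β, 1)`, `Γ_b = frameElt σ f b α β`: for every vertex type `t`,
`fixedVertexCount σ ϖ t Γ_b = #{M : M a type-t vertex lattice of (K³, diag(d_{s_ω b})), T·M = M}`, `s_ω b = (ε₁(b) = −1, ε₂(b) = −1, (ε₁ε₂)(b) = −1 XOR ω)` (tables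
`(ff,ff,tt,tt)`, `(ff,tt,ff,tt)`, `(ff,tt,tt,ff)` on `b = 0,1,2,3`), `d_s j = c` if `s j` else `1`.  (★ p855115 proves this as a private step and exports only the sum over `b`.)
[cite: Rogawski1990, §3.6 pp. 28–29; §4.9 Prop. 4.9.1 (a) p. 55] [cite: LanglandsShelstad1987, §1.3] [cite: Jacobowitz1962, §4] -/
theorem fixedVertexCount_frameElt_eq_ncard_signClass (hσ : ∀ x, σ (σ x) = x) (hvσ : ∀ a, Valued.v (σ a) = Valued.v a)
    (hϖ : Valued.v ϖ = WithZero.exp (-1 : ℤ)) (heven : ∀ x : K, σ x = x → x ≠ 0 → ∃ n : ℤ, Valued.v x = WithZero.exp (2 * n))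
    {c : K} (hσc : σ c = c) (hvc : Valued.v c = 1)
    (hdich : ∀ x : K, σ x = x → x ≠ 0 → (∃ z : K, z * σ z = x) ∨ ∃ z : K, z * σ z = c * x)
    (ω : Bool) (hω : normSign σ (-1 : K) = -1 ↔ ω = true)
    {f : Fin 4 → Fin 3 → (Fin 3 → K)} (hf : IsFourFrameFamily σ f) (α β : K)
    (T : GL (Fin 3) K) (hT : (T : Matrix (Fin 3) (Fin 3) K) = Matrix.diagonal ![α, β, 1])
    (Γ : Fin 4 → GL (Fin 3) K) (hΓ : ∀ b, (Γ b : Matrix (Fin 3) (Fin 3) K) = frameElt σ f b α β) (b : Fin 4) (t : ℕ) :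
    fixedVertexCount σ ϖ t (Γ b) =
      {M : Submodule 𝒪[K] (Fin 3 → K) | IsVertexLattice σ ϖ (Matrix.diagonal fun j =>
          if (![(![false, false, true, true] : Fin 4 → Bool) b, (![false, true, false, true] : Fin 4 → Bool) b,
                xor ((![false, true, true, false] : Fin 4 → Bool) b) ω] : Fin 3 → Bool) j then c else (1 : K)) t M ∧ mapGL T M = M}.ncard := by
  classical
  have hc0 : c ≠ 0 := fun h => by rw [h, map_zero] at hvc; exact zero_ne_one hvc
  let e1 : Fin 4 → Bool := ![false, false, true, true]
  let e2 : Fin 4 → Bool := ![false, true, false, true]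
  let e12 : Fin 4 → Bool := ![false, true, true, false]
  let sb : Fin 3 → Bool := ![e1 b, e2 b, xor (e12 b) ω]
  change fixedVertexCount σ ϖ t (Γ b) =
    {M : Submodule 𝒪[K] (Fin 3 → K) | IsVertexLattice σ ϖ (Matrix.diagonal fun j => if sb j then c else (1 : K)) t M ∧ mapGL T M = M}.ncard
  obtain ⟨d, hd1, hσd, hcls, hcount⟩ := fixedVertexCount_frameElt_eq_ncard_diagonal_model hσ hvσ hϖ heven hf b
  rw [hcount α β T (Γ b) hT (hΓ b) t]
  -- the classes of `d`: `(ε₁, ε₂, ω(−1) ε₁ ε₂)`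
  obtain ⟨-, -, h0, h1, h2⟩ := hf b
  have hd0 : ∀ i, d i ≠ 0 := fun i h => by
    have := hd1 i; rw [h, map_zero] at this; exact zero_ne_one this
  -- `normSign σ (d i) = -1 ↔ sb i`
  have hsign : ∀ i : Fin 3, (normSign σ (d i) = -1 ↔ sb i = true) := by
    have hωcases := normSign_eq_one_or σ (-1 : K)
    intro i
    fin_cases i
    · change normSign σ (d 0) = -1 ↔ e1 b = true
      rw [hcls 0, h0]
      fin_cases b <;> simp [e1, signPair]
    · change normSign σ (d 1) = -1 ↔ e2 b = true
      rw [hcls 1, h1]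
      fin_cases b <;> simp [e2, signPair]
    · change normSign σ (d 2) = -1 ↔ xor (e12 b) ω = true
      rw [hcls 2, h2]
      rcases hωcases with hp | hm
      · have hωf : ω = false := by
          cases ω
          · rfl
          · exact absurd (hω.2 rfl) (by rw [hp]; norm_num)
        rw [hp, hωf]
        fin_cases b <;> simp [e12, signPair]
      · have hωt : ω = true := hω.1 hm
        rw [hm, hωt]
        fin_cases b <;> simp [e12, signPair]
  -- transport `diag(d)` to the representative form `diag(d_{sb})`
  refine ncard_fixed_diagonal_eq_of_exists_norm σ ϖ (d := fun i => if sb i then c else (1 : K)) (d' := d) (fun i => ?_) _ T hT t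
  obtain ⟨z, hz0, hz⟩ := exists_rep_of_dichotomy σ hσc hc0 hdich (hσd i) (hd0 i)
  refine ⟨z, hz0, ?_⟩
  by_cases hs : sb i = true
  · rw [if_pos ((hsign i).2 hs)] at hz
    simpa [hs] using hz
  · have hns : ¬ normSign σ (d i) = -1 := fun h => hs ((hsign i).1 h)
    rw [if_neg hns] at hz
    simpa [hs] using hz

/-! ## §2 The κ-weighted sums, frame by frame (sign-exact) -/

/-- **THE κ-WEIGHTED FOUR-FRAME SUM IN MODEL CURRENCY** (sign-exact; it serves the κ-amplitude AND the κ-sign law): for every `i ∈ Fin 3` and vertex type `t`,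
`Σ_b κ_i(b) · n_t(Γ_b) = Σ_b κ_i(b) · C_t(s_ω b)` — §1 summed against ★ #0a `kappaChar`. [cite: Rogawski1990, §4.9 Prop. 4.9.1 (a) p. 55] [cite: LanglandsShelstad1987, §1.3] -/
theorem kappaSum_fixedVertexCount_eq (hσ : ∀ x, σ (σ x) = x) (hvσ : ∀ a, Valued.v (σ a) = Valued.v a)
    (hϖ : Valued.v ϖ = WithZero.exp (-1 : ℤ)) (heven : ∀ x : K, σ x = x → x ≠ 0 → ∃ n : ℤ, Valued.v x = WithZero.exp (2 * n))
    {c : K} (hσc : σ c = c) (hvc : Valued.v c = 1)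
    (hdich : ∀ x : K, σ x = x → x ≠ 0 → (∃ z : K, z * σ z = x) ∨ ∃ z : K, z * σ z = c * x)
    (ω : Bool) (hω : normSign σ (-1 : K) = -1 ↔ ω = true)
    {f : Fin 4 → Fin 3 → (Fin 3 → K)} (hf : IsFourFrameFamily σ f) (α β : K)
    (T : GL (Fin 3) K) (hT : (T : Matrix (Fin 3) (Fin 3) K) = Matrix.diagonal ![α, β, 1])
    (Γ : Fin 4 → GL (Fin 3) K) (hΓ : ∀ b, (Γ b : Matrix (Fin 3) (Fin 3) K) = frameElt σ f b α β) (i : Fin 3) (t : ℕ) :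
    (∑ b : Fin 4, kappaChar i b * (fixedVertexCount σ ϖ t (Γ b) : ℤ)) =
      ∑ b : Fin 4, kappaChar i b * ({M : Submodule 𝒪[K] (Fin 3 → K) | IsVertexLattice σ ϖ (Matrix.diagonal fun j =>
          if (![(![false, false, true, true] : Fin 4 → Bool) b, (![false, true, false, true] : Fin 4 → Bool) b,
                xor ((![false, true, true, false] : Fin 4 → Bool) b) ω] : Fin 3 → Bool) j then c else (1 : K)) t M ∧ mapGL T M = M}.ncard : ℤ) :=
  Finset.sum_congr rfl fun b _ => by
    rw [fixedVertexCount_frameElt_eq_ncard_signClass hσ hvσ hϖ heven hσc hvc hdich ω hω hf α β T hT Γ hΓ b t]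

end PerFrame

/-! ## §3 The κ-amplitude law at a datum from (NI2) + (KMS); the record instance with (NI2) discharged by ★ `normIndexTwo` -/

section Reduction

variable {K : Type} [Field K] [Valued K ℤᵐ⁰] [CompleteSpace K] [Fintype 𝓀[K]]

/-- **THE κ-AMPLITUDE LAW AT A DATUM FROM (NI2) + (KMS)** (any schedule `shift`, threshold `N₀`, type shift `τ`): `KappaAmplitudeLawAtS shift N₀ τ σ ϖ d t` (★ №1-R §S verbatim: behind
the datum, for every four-frame family, element datum at `N₀ d`, frames `Γ_b`, `2k + d = Σn + 2`, `i`, `2B = n_i − d + 2 − 2·shift d t`: `|Σ_b κ_i(b) n₀(Γ_b)| = ampl q k B ∧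
|Σ_b κ_i(b) n₂(Γ_b)| = ampl q k (B + τ d)`) follows from a `σ`-fixed unit `c` with the index-two dichotomy (NI2) and the κ-MODEL SUM (KMS) at the same datum — by §2 and the reading
`ω := (normSign σ (−1) = −1)`.  The κ-twin of ★ p855240. [cite: Rogawski1990, §4.9 Prop. 4.9.1 (a) p. 55] [cite: LanglandsShelstad1987, §1.3] -/
theorem kappaAmplitudeLawAtS_of_normIndexTwo_of_kappaModelSum (shift : ℕ → ℕ → ℤ) (N₀ : ℕ → ℕ) (τ : ℕ → ℤ) (σ : K →+* K) (ϖ : K) (d t : ℕ)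
    (hNI : ∃ c : K, σ c = c ∧ Valued.v c = 1 ∧ ∀ x : K, σ x = x → x ≠ 0 → (∃ z : K, z * σ z = x) ∨ ∃ z : K, z * σ z = c * x)
    (hKMS : ∀ c : K, σ c = c → Valued.v c = 1 → (∀ x : K, σ x = x → x ≠ 0 → (∃ z : K, z * σ z = x) ∨ ∃ z : K, z * σ z = c * x) →
      ∀ ω : Bool, (normSign σ (-1 : K) = -1 ↔ ω = true) →
      ∀ (α β : K) (n₁ n₂ n₃ : ℕ), IsElementDatum σ ϖ (N₀ d) α β n₁ n₂ n₃ →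
      ∀ (T : GL (Fin 3) K), (T : Matrix (Fin 3) (Fin 3) K) = Matrix.diagonal ![α, β, 1] →
      ∀ (k : ℕ), 2 * k + d = n₁ + n₂ + n₃ + 2 →
      ∀ (i : Fin 3) (B : ℤ), 2 * B = ((![n₁, n₂, n₃] : Fin 3 → ℕ) i : ℤ) - d + 2 - 2 * shift d t →
        |((∑ b : Fin 4, kappaChar i b * ({M : Submodule 𝒪[K] (Fin 3 → K) | IsVertexLattice σ ϖ (Matrix.diagonal fun j =>
            if (![(![false, false, true, true] : Fin 4 → Bool) b, (![false, true, false, true] : Fin 4 → Bool) b,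
                  xor ((![false, true, true, false] : Fin 4 → Bool) b) ω] : Fin 3 → Bool) j then c else (1 : K)) 0 M ∧ mapGL T M = M}.ncard : ℤ) : ℤ) : ℚ)| =
          ampl (Fintype.card 𝓀[K]) k B ∧
        |((∑ b : Fin 4, kappaChar i b * ({M : Submodule 𝒪[K] (Fin 3 → K) | IsVertexLattice σ ϖ (Matrix.diagonal fun j =>
            if (![(![false, false, true, true] : Fin 4 → Bool) b, (![false, true, false, true] : Fin 4 → Bool) b,
                  xor ((![false, true, true, false] : Fin 4 → Bool) b) ω] : Fin 3 → Bool) j then c else (1 : K)) 2 M ∧ mapGL T M = M}.ncard : ℤ) : ℤ) : ℚ)| =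
          ampl (Fintype.card 𝓀[K]) k (B + τ d)) :
    KappaAmplitudeLawAtS shift N₀ τ σ ϖ d t := by
  intro hD f hf α β n₁ n₂ n₃ hE Γ hΓ k hk i B hB
  obtain ⟨hσ, hvσ, hϖ, heven, -, -, -⟩ := hD
  obtain ⟨c, hσc, hvc, hdich⟩ := hNI
  -- `α, β` are units (`α·σα = 1`)
  have hα0 : α ≠ 0 := fun h => by have h1 := hE.1; rw [h, zero_mul] at h1; exact zero_ne_one h1
  have hβ0 : β ≠ 0 := fun h => by have h1 := hE.2.1; rw [h, zero_mul] at h1; exact zero_ne_one h1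
  -- the diagonal literal `T = diag(α, β, 1)` as a `GL₃` element
  let T : GL (Fin 3) K :=
    ⟨Matrix.diagonal ![α, β, 1], Matrix.diagonal ![α⁻¹, β⁻¹, 1],
      by rw [Matrix.diagonal_mul_diagonal, ← Matrix.diagonal_one]; congr 1; funext j; fin_cases j <;> simp [hα0, hβ0],
      by rw [Matrix.diagonal_mul_diagonal, ← Matrix.diagonal_one]; congr 1; funext j; fin_cases j <;> simp [hα0, hβ0]⟩
  have hT : (T : Matrix (Fin 3) (Fin 3) K) = Matrix.diagonal ![α, β, 1] := rfl
  -- the class of `−1`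
  set ω : Bool := decide (normSign σ (-1 : K) = -1) with hω_def
  have hω : normSign σ (-1 : K) = -1 ↔ ω = true := by rw [hω_def, decide_eq_true_iff]
  have hK := hKMS c hσc hvc hdich ω hω α β n₁ n₂ n₃ hE T hT k hk i B hB
  rw [kappaSum_fixedVertexCount_eq hσ hvσ hϖ heven hσc hvc hdich ω hω hf α β T hT Γ hΓ i 0,
    kappaSum_fixedVertexCount_eq hσ hvσ hϖ heven hσc hvc hdich ω hω hf α β T hT Γ hΓ i 2]
  exact hK

/-- **THE FENCED FORM**: `DyadicFence (KappaAmplitudeLawAtS shift N₀ τ σ ϖ d t)` from (NI2) + (KMS) (the fence only weakens, ★ №1 `dyadicFence_of`). [cite: Rogawski1990, §4.9 Prop. 4.9.1 (a) p. 55] -/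
theorem dyadicFence_kappaAmplitudeLawAtS_of_normIndexTwo_of_kappaModelSum (shift : ℕ → ℕ → ℤ) (N₀ : ℕ → ℕ) (τ : ℕ → ℤ) (σ : K →+* K) (ϖ : K) (d t : ℕ)
    (hNI : ∃ c : K, σ c = c ∧ Valued.v c = 1 ∧ ∀ x : K, σ x = x → x ≠ 0 → (∃ z : K, z * σ z = x) ∨ ∃ z : K, z * σ z = c * x)
    (hKMS : ∀ c : K, σ c = c → Valued.v c = 1 → (∀ x : K, σ x = x → x ≠ 0 → (∃ z : K, z * σ z = x) ∨ ∃ z : K, z * σ z = c * x) →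
      ∀ ω : Bool, (normSign σ (-1 : K) = -1 ↔ ω = true) →
      ∀ (α β : K) (n₁ n₂ n₃ : ℕ), IsElementDatum σ ϖ (N₀ d) α β n₁ n₂ n₃ →
      ∀ (T : GL (Fin 3) K), (T : Matrix (Fin 3) (Fin 3) K) = Matrix.diagonal ![α, β, 1] →
      ∀ (k : ℕ), 2 * k + d = n₁ + n₂ + n₃ + 2 →
      ∀ (i : Fin 3) (B : ℤ), 2 * B = ((![n₁, n₂, n₃] : Fin 3 → ℕ) i : ℤ) - d + 2 - 2 * shift d t →
        |((∑ b : Fin 4, kappaChar i b * ({M : Submodule 𝒪[K] (Fin 3 → K) | IsVertexLattice σ ϖ (Matrix.diagonal fun j =>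
            if (![(![false, false, true, true] : Fin 4 → Bool) b, (![false, true, false, true] : Fin 4 → Bool) b,
                  xor ((![false, true, true, false] : Fin 4 → Bool) b) ω] : Fin 3 → Bool) j then c else (1 : K)) 0 M ∧ mapGL T M = M}.ncard : ℤ) : ℤ) : ℚ)| =
          ampl (Fintype.card 𝓀[K]) k B ∧
        |((∑ b : Fin 4, kappaChar i b * ({M : Submodule 𝒪[K] (Fin 3 → K) | IsVertexLattice σ ϖ (Matrix.diagonal fun j =>
            if (![(![false, false, true, true] : Fin 4 → Bool) b, (![false, true, false, true] : Fin 4 → Bool) b,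
                  xor ((![false, true, true, false] : Fin 4 → Bool) b) ω] : Fin 3 → Bool) j then c else (1 : K)) 2 M ∧ mapGL T M = M}.ncard : ℤ) : ℤ) : ℚ)| =
          ampl (Fintype.card 𝓀[K]) k (B + τ d)) :
    DyadicFence (K := K) (KappaAmplitudeLawAtS shift N₀ τ σ ϖ d t) :=
  dyadicFence_of (kappaAmplitudeLawAtS_of_normIndexTwo_of_kappaModelSum shift N₀ τ σ ϖ d t hNI hKMS)

/-- **THE RECORD INSTANCE WITH (NI2) DISCHARGED — the conclusion of `U3_Laws.stub_U3_kappaAbsLawR` at the datum from (KMS) alone**: at the re-cut schedule `shiftR` (`d − d mod 2`) and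
the parameters of record `(depthOfRecord, tauOfRecord)`, the κ-model sum (KMS) implies `DyadicFence (KappaAmplitudeLawAtR depthOfRecord tauOfRecord σ ϖ d t)`; the (NI2) input is ★
`normIndexTwo` (★ p855402 over ★ p855352 ∕ p855374).  So the κ-amplitude head reduces BY NAME to ONE frame-free statement:
`stub_U3_kappaAbsLawR := fun σ ϖ d t => dyadicFence_kappaAmplitudeLawAtR_of_kappaModelSum σ ϖ d t ‹KMS at (σ, ϖ, d, t)›`. [cite: Rogawski1990, §4.9 Prop. 4.9.1 (a) p. 55] [cite: LanglandsShelstad1987, §1.3] -/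
theorem dyadicFence_kappaAmplitudeLawAtR_of_kappaModelSum (σ : K →+* K) (ϖ : K) (d t : ℕ)
    (hKMS : ∀ c : K, σ c = c → Valued.v c = 1 → (∀ x : K, σ x = x → x ≠ 0 → (∃ z : K, z * σ z = x) ∨ ∃ z : K, z * σ z = c * x) →
      ∀ ω : Bool, (normSign σ (-1 : K) = -1 ↔ ω = true) →
      ∀ (α β : K) (n₁ n₂ n₃ : ℕ), IsElementDatum σ ϖ (depthOfRecord d) α β n₁ n₂ n₃ →
      ∀ (T : GL (Fin 3) K), (T : Matrix (Fin 3) (Fin 3) K) = Matrix.diagonal ![α, β, 1] →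
      ∀ (k : ℕ), 2 * k + d = n₁ + n₂ + n₃ + 2 →
      ∀ (i : Fin 3) (B : ℤ), 2 * B = ((![n₁, n₂, n₃] : Fin 3 → ℕ) i : ℤ) - d + 2 - 2 * shiftR d t →
        |((∑ b : Fin 4, kappaChar i b * ({M : Submodule 𝒪[K] (Fin 3 → K) | IsVertexLattice σ ϖ (Matrix.diagonal fun j =>
            if (![(![false, false, true, true] : Fin 4 → Bool) b, (![false, true, false, true] : Fin 4 → Bool) b,
                  xor ((![false, true, true, false] : Fin 4 → Bool) b) ω] : Fin 3 → Bool) j then c else (1 : K)) 0 M ∧ mapGL T M = M}.ncard : ℤ) : ℤ) : ℚ)| =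
          ampl (Fintype.card 𝓀[K]) k B ∧
        |((∑ b : Fin 4, kappaChar i b * ({M : Submodule 𝒪[K] (Fin 3 → K) | IsVertexLattice σ ϖ (Matrix.diagonal fun j =>
            if (![(![false, false, true, true] : Fin 4 → Bool) b, (![false, true, false, true] : Fin 4 → Bool) b,
                  xor ((![false, true, true, false] : Fin 4 → Bool) b) ω] : Fin 3 → Bool) j then c else (1 : K)) 2 M ∧ mapGL T M = M}.ncard : ℤ) : ℤ) : ℚ)| =
          ampl (Fintype.card 𝓀[K]) k (B + tauOfRecord d)) :
    DyadicFence (K := K) (KappaAmplitudeLawAtR depthOfRecord tauOfRecord σ ϖ d t) := by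
  intro _ hD
  exact kappaAmplitudeLawAtS_of_normIndexTwo_of_kappaModelSum shiftR depthOfRecord tauOfRecord σ ϖ d t (normIndexTwo σ ϖ d t hD) hKMS hD

end Reduction

end Summit.HodgeConjecture.HodgeConjecture.Cruxes.H413.F0P3cDyRamKappaLawOfModelCounts

end
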